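import Summits.AnomalousDissipation.AnomalousDissipation.Theorems.SolenoidalFractalHomogenisationLagrangianStepLadderHypocoerciveStart
import HarnessLib

/-!
# K1L_D `stub_D1_V0thg` (stmt-AnomalousDissipation-27980), R3′ lane «SidebandTailCrushing» (tenure D28-16 (3)) — file F1d:
# the ABSTRACT three-term hypocoercivity lemma with a NON-SYMMETRIC DAMPING (odd viscosity kept inside `D`; on top of files F1/F1c)

Helper file of route `SolenoidalFractalHomogenisation` (prover seat `ad-k1l-cellLawV-w1` g10; plan memo
`Cruxes/LagrangianRenormalisationStepDesign/Lines/onelevel-vtheta-R3-plan.md` §4; `--supports stmt-AnomalousDissipation-27980 --as helper`).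

SETTING (generalises files F1/F1c: here `D t` is NOT assumed symmetric — the design viscosity has an odd part, `Torus.OddSmall` — and no adjoint /
symmetrisation is needed downstream).  A real inner-product space `F`, a subspace `V`, bounded operators `K` ("site index") and `C` (symmetric, "bond
operator"), a family `B t` of skew operators with `[K, B t] = G(t)•C`, a family `D t` of operators with `⟪D t u, u⟫ ≥ 0` commuting with `K`, a scalar
`G t ∈ [Gm, GM]`, `Gm ≥ 0`, and a curve `y` with `y t ∈ V` solving `y′ = B(t) y − D(t) y` on `[t₀,t₁]`.  Quantitative hypotheses on `V`: h1 `lo₁‖Ku‖² ≤ ⟪Du,u⟫`,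
h2 `⟪D(Cu),Cu⟫ ≤ CJ⟪Du,u⟫`, h3 `‖Cu‖² ≤ A‖u‖²`, h4 `⟪Ku,[C,B t]u⟫ ≥ −η₀⟪Du,u⟫ − η₁⟪D(Ku),Ku⟫`, h5 `‖u‖² ≤ U₁‖Cu‖² + U₂‖Ku‖² + U₃⟪Du,u⟫`, and the
ODD-DAMPING allowance h6 `(⟪Du, C(Ku)⟫ − ⟪D(C(Ku)), u⟫) + (⟪D(Ku), Cu⟫ − ⟪D(Cu), Ku⟫) ≤ η₂⟪Du,u⟫ + η₃⟪D(Ku),Ku⟫` (vanishes for symmetric `D`).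

RESULT (`hypocoercive_decay''`).  Under polynomial constraints (P1) `4Aβ² ≤ α`, (P2) `16·CJ·β² ≤ α`, (P3) `2α²GM² ≤ βGm lo₁`, (P4) `16βη₀ ≤ 1`,
(P4b) `8βη₁ ≤ α`, (P4c) `16βη₂ ≤ 1`, (P4d) `8βη₃ ≤ α`, (P5) `6·lam·α ≤ lo₁`, (P6) `6·lam·U₂ ≤ lo₁`, (P7) `6·lam·U₃ ≤ 1`, (P8) `3·lam·U₁ ≤ 2βGm`:
`‖y t₁‖² ≤ 3·e^{−lam(t₁−t₀)}·(‖y t₀‖² + α‖K(y t₀)‖²)` and, with a mean-value start, `‖y t₁‖² ≤ 3(1 + α/(2δ₁lo₁))e^{−lam(t₁−t₀−δ₁)}‖y t₀‖²`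
(`hypocoercive_decay_started''`).  Young's inequality for a positive NON-symmetric form bounds the symmetrised pairing `⟪Du,v⟫ + ⟪Dv,u⟫`; the antisymmetric
remainders are exactly h6.  Elementary, sorry-free; no definition, no named fact.  NOT a proof of `stub_D1_V0thg`, of K1L_D or of AD; rung F-D1.A0.
-/

set_option linter.dupNamespace false -- single-conjunct summit: `Summit.AnomalousDissipation.AnomalousDissipation.…` is the mandated namespace

namespace Summit.AnomalousDissipation.AnomalousDissipation.Theorems.SolenoidalFractalHomogenisation.LagrangianStep.LadderCrush

open Set
open scoped InnerProductSpace

noncomputable section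

variable {F : Type*} [NormedAddCommGroup F] [InnerProductSpace ℝ F]

/-! ## §0 Young's inequality for a positive, possibly non-symmetric form -/

/-- **Young for a positive form without symmetry**: `⟪Du,u⟫ ≥ 0 ∀u` gives `⟪Du,v⟫ + ⟪Dv,u⟫ ≤ ε⟪Du,u⟫ + ε⁻¹⟪Dv,v⟫` (`ε > 0`).
[cite: Villani2009, Part I §2 (A*A + B framework: elementary inequalities)] -/
theorem young_form_add (D : F →L[ℝ] F) (hp : ∀ u, 0 ≤ ⟪D u, u⟫_ℝ) {ε : ℝ} (hε : 0 < ε) (u v : F) :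
    ⟪D u, v⟫_ℝ + ⟪D v, u⟫_ℝ ≤ ε * ⟪D u, u⟫_ℝ + ε⁻¹ * ⟪D v, v⟫_ℝ := by
  have h0 := hp (ε • u - v)
  rw [map_sub, map_smul, inner_sub_left, inner_sub_right, inner_sub_right, real_inner_smul_left, real_inner_smul_left,
    real_inner_smul_right, real_inner_smul_right] at h0
  have h1 : ε * (⟪D u, v⟫_ℝ + ⟪D v, u⟫_ℝ) ≤ ε * (ε * ⟪D u, u⟫_ℝ) + ⟪D v, v⟫_ℝ := by linarith
  have h2 := mul_le_mul_of_nonneg_left h1 (inv_pos.mpr hε).le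
  have e1 : ε⁻¹ * (ε * (⟪D u, v⟫_ℝ + ⟪D v, u⟫_ℝ)) = ⟪D u, v⟫_ℝ + ⟪D v, u⟫_ℝ := by field_simp
  have e2 : ε⁻¹ * (ε * (ε * ⟪D u, u⟫_ℝ) + ⟪D v, v⟫_ℝ) = ε * ⟪D u, u⟫_ℝ + ε⁻¹ * ⟪D v, v⟫_ℝ := by field_simp
  rw [e1, e2] at h2
  exact h2

/-! ## §1 The scalar bookkeeping (commutator and odd-damping allowances) -/

/-- **Scalar core of the dissipation inequality**: the real-arithmetic combination of the Young bounds, the signed-commutator allowance,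
the coercivity inequality and (P1)–(P8).  All variables are real numbers standing for the norms / forms of `dissipation_pointwise`
(`k = ‖Ku‖`, `c = ‖Cu‖`, `n = ‖u‖`, `d0 = ⟪Du,u⟫`, `dK = ⟪DKu,Ku⟫`, `dC = ⟪DCu,Cu⟫`, `dCK = ⟪DCKu,CKu⟫`, `x = ⟪Ku,Cu⟫`,
`m = ⟪Ku,[C,B]u⟫`, `p = ⟪DKu,Cu⟫`, `q = ⟪Du,CKu⟫`). [cite: BedrossianCotiZelati2017, §2] -/
theorem scalar_core'' {k c n d0 dK dC dCK x m od p q g Gm GM lo₁ CJ A η₀ η₁ η₂ η₃ U₁ U₂ U₃ α β lam : ℝ}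
    (hk : 0 ≤ k) (hc : 0 ≤ c) (hd0 : 0 ≤ d0) (hdK : 0 ≤ dK)
    (hGm : 0 ≤ Gm) (hg : Gm ≤ g ∧ g ≤ GM) (hlo₁ : 0 < lo₁) (hCJ : 0 < CJ) (hα : 0 < α) (hβ : 0 < β)
    (hlam : 0 ≤ lam)
    (h1 : lo₁ * k ^ 2 ≤ d0) (h2 : dC ≤ CJ * d0) (h2' : dCK ≤ CJ * dK) (h3 : c ^ 2 ≤ A * n ^ 2) (h4 : -(η₀ * d0 + η₁ * dK) ≤ m)
    (h5 : n ^ 2 ≤ U₁ * c ^ 2 + U₂ * k ^ 2 + U₃ * d0) (hx : |x| ≤ k * c) (h6 : od ≤ η₂ * d0 + η₃ * dK)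
    (yqp : 2 * q + 2 * p ≤ (4 * β * CJ / α) * d0 + (4 * β * CJ / α)⁻¹ * dCK + (α / (4 * β)) * dK + (α / (4 * β))⁻¹ * dC + od)
    (P1 : 4 * A * β ^ 2 ≤ α) (P2 : 16 * CJ * β ^ 2 ≤ α) (P3 : 2 * α ^ 2 * GM ^ 2 ≤ β * Gm * lo₁) (P4 : 16 * β * η₀ ≤ 1) (P4b : 8 * β * η₁ ≤ α)
    (P4c : 16 * β * η₂ ≤ 1) (P4d : 8 * β * η₃ ≤ α)
    (P5 : 6 * lam * α ≤ lo₁) (P6 : 6 * lam * U₂ ≤ lo₁) (P7 : 6 * lam * U₃ ≤ 1) (P8 : 3 * lam * U₁ ≤ 2 * β * Gm) :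
    -2 * d0 + 2 * α * g * x - 2 * α * dK - 2 * β * g * c ^ 2 - 2 * β * m + 2 * β * q + 2 * β * p
      ≤ -(lam * (n ^ 2 + α * k ^ 2 - 2 * β * x)) := by
  have hg0 : 0 ≤ g := hGm.trans hg.1
  have hc2 : 0 ≤ c ^ 2 := by positivity
  have hk2 : 0 ≤ k ^ 2 := by positivity
  have hkc : 0 ≤ k * c := mul_nonneg hk hc
  have hxle : x ≤ k * c := (le_abs_self x).trans hx
  have hxge : -x ≤ k * c := (neg_le_abs x).trans hx
  -- (a) the hopping cross term of `‖Ku‖²`: 2αg x ≤ d0/2 + βGm c²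
  have ha : 2 * α * g * x ≤ d0 / 2 + β * Gm * c ^ 2 := by
    have hαg : 0 ≤ 2 * α * g := by positivity
    have step1 : 2 * α * g * x ≤ 2 * α * g * (k * c) := mul_le_mul_of_nonneg_left hxle hαg
    have sq : 2 * (lo₁ * k) * (2 * α * g * c) ≤ (lo₁ * k) ^ 2 + (2 * α * g * c) ^ 2 := two_mul_le_add_sq _ _
    have step3 : lo₁ * (lo₁ * k ^ 2) ≤ lo₁ * d0 := mul_le_mul_of_nonneg_left h1 hlo₁.le
    have hg2 : g ^ 2 ≤ GM ^ 2 := pow_le_pow_left₀ hg0 hg.2 2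
    have t1 : α ^ 2 * g ^ 2 ≤ α ^ 2 * GM ^ 2 := mul_le_mul_of_nonneg_left hg2 (sq_nonneg α)
    have t2 : 4 * α ^ 2 * g ^ 2 ≤ 2 * (β * Gm * lo₁) := by linarith
    have step4 : 4 * α ^ 2 * g ^ 2 * c ^ 2 ≤ 2 * (β * Gm * lo₁) * c ^ 2 := mul_le_mul_of_nonneg_right t2 hc2
    have step5 : lo₁ * (4 * α * g * (k * c)) ≤ lo₁ * (d0 + 2 * β * Gm * c ^ 2) := by linarith
    have step6 : 4 * α * g * (k * c) ≤ d0 + 2 * β * Gm * c ^ 2 := le_of_mul_le_mul_left step5 hlo₁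
    linarith
  -- (b) the main good term
  have hb : 2 * β * Gm * c ^ 2 ≤ 2 * β * g * c ^ 2 := by
    have t := mul_le_mul_of_nonneg_left hg.1 (by positivity : (0:ℝ) ≤ 2 * β * c ^ 2)
    linarith
  -- (c) the commutator allowance
  have hc' : -(2 * β * m) ≤ d0 / 8 + α / 4 * dK := by
    have t1 : 2 * β * (-(η₀ * d0 + η₁ * dK)) ≤ 2 * β * m := mul_le_mul_of_nonneg_left h4 (by positivity)
    have t2 : 16 * β * η₀ * d0 ≤ 1 * d0 := mul_le_mul_of_nonneg_right P4 hd0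
    have t3 : 8 * β * η₁ * dK ≤ α * dK := mul_le_mul_of_nonneg_right P4b hdK
    linarith
  -- (f) the odd-damping allowance: β·od ≤ d0/16 + (α/8) dK
  have hod : β * od ≤ d0 / 16 + α / 8 * dK := by
    have t1 : β * od ≤ β * (η₂ * d0 + η₃ * dK) := mul_le_mul_of_nonneg_left h6 hβ.le
    have t2 : 16 * β * η₂ * d0 ≤ 1 * d0 := mul_le_mul_of_nonneg_right P4c hd0
    have t3 : 8 * β * η₃ * dK ≤ α * dK := mul_le_mul_of_nonneg_right P4d hdK
    linarith
  -- (d)+(e) the two damping cross terms together: 2β(q + p) ≤ d0/2 + (α/2) dK + β·od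
  have hcoef : 4 * β ^ 2 * CJ / α ≤ 1 / 4 := by rw [div_le_iff₀ hα]; linarith
  have hde : 2 * β * q + 2 * β * p ≤ d0 / 2 + α / 2 * dK + β * od := by
    have hinv1 : (4 * β * CJ / α)⁻¹ = α / (4 * β * CJ) := by rw [inv_div]
    have hinv2 : (α / (4 * β))⁻¹ = 4 * β / α := by rw [inv_div]
    rw [hinv1, hinv2] at yqp
    have t0 := mul_le_mul_of_nonneg_left yqp hβ.le
    have t1 : β * ((α / (4 * β * CJ)) * dCK) ≤ β * ((α / (4 * β * CJ)) * (CJ * dK)) :=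
      mul_le_mul_of_nonneg_left (mul_le_mul_of_nonneg_left h2' (by positivity)) hβ.le
    have t2 : β * ((4 * β / α) * dC) ≤ β * ((4 * β / α) * (CJ * d0)) :=
      mul_le_mul_of_nonneg_left (mul_le_mul_of_nonneg_left h2 (by positivity)) hβ.le
    have e1 : β * ((α / (4 * β * CJ)) * (CJ * dK)) = α / 4 * dK := by field_simp
    have e2 : β * ((4 * β * CJ / α) * d0) = (4 * β ^ 2 * CJ / α) * d0 := by ring
    have e3 : β * ((α / (4 * β)) * dK) = α / 4 * dK := by field_simp
    have e4 : β * ((4 * β / α) * (CJ * d0)) = (4 * β ^ 2 * CJ / α) * d0 := by ring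
    have t3 : 4 * β ^ 2 * CJ / α * d0 ≤ 1 / 4 * d0 := mul_le_mul_of_nonneg_right hcoef hd0
    linarith
  -- the right-hand side
  have hr1 : 3 / 2 * lam * (α * k ^ 2) ≤ d0 / 4 := by
    have t : 6 * lam * α * k ^ 2 ≤ lo₁ * k ^ 2 := mul_le_mul_of_nonneg_right P5 hk2
    linarith
  have hr2 : 3 / 2 * lam * n ^ 2 ≤ d0 / 2 + β * Gm * c ^ 2 := by
    have t0 : 3 / 2 * lam * n ^ 2 ≤ 3 / 2 * lam * (U₁ * c ^ 2 + U₂ * k ^ 2 + U₃ * d0) :=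
      mul_le_mul_of_nonneg_left h5 (by positivity)
    have t1 : 3 * lam * U₁ * c ^ 2 ≤ 2 * β * Gm * c ^ 2 := mul_le_mul_of_nonneg_right P8 hc2
    have t2 : 6 * lam * U₂ * k ^ 2 ≤ lo₁ * k ^ 2 := mul_le_mul_of_nonneg_right P6 hk2
    have t3 : 6 * lam * U₃ * d0 ≤ 1 * d0 := mul_le_mul_of_nonneg_right P7 hd0
    linarith
  have hΦ : n ^ 2 + α * k ^ 2 - 2 * β * x ≤ 3 / 2 * (n ^ 2 + α * k ^ 2) := by
    have h1' : 2 * β * (k * c) ≤ α / 2 * k ^ 2 + 2 * β ^ 2 / α * c ^ 2 := by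
      have e : α / 2 * k ^ 2 + 2 * β ^ 2 / α * c ^ 2 - 2 * β * (k * c) = (α * k - 2 * β * c) ^ 2 / (2 * α) := by
        field_simp; ring
      have : 0 ≤ (α * k - 2 * β * c) ^ 2 / (2 * α) := div_nonneg (sq_nonneg _) (by linarith)
      linarith
    have h2'' : 2 * β ^ 2 / α * c ^ 2 ≤ 1 / 2 * n ^ 2 := by
      have t : 2 * β ^ 2 / α * c ^ 2 ≤ 2 * β ^ 2 / α * (A * n ^ 2) := mul_le_mul_of_nonneg_left h3 (by positivity)
      have hcoef' : 2 * β ^ 2 / α * A ≤ 1 / 2 := by rw [div_mul_eq_mul_div, div_le_iff₀ hα]; linarith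
      have t' : 2 * β ^ 2 / α * A * n ^ 2 ≤ 1 / 2 * n ^ 2 := mul_le_mul_of_nonneg_right hcoef' (by positivity)
      linarith
    have t : 2 * β * (-x) ≤ 2 * β * (k * c) := mul_le_mul_of_nonneg_left hxge (by positivity)
    linarith
  have hfin : lam * (n ^ 2 + α * k ^ 2 - 2 * β * x) ≤ lam * (3 / 2 * (n ^ 2 + α * k ^ 2)) :=
    mul_le_mul_of_nonneg_left hΦ hlam
  have hαdK : 0 ≤ α * dK := mul_nonneg hα.le hdK
  linarith

/-! ## §2 The pointwise dissipation inequality -/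

/-- **Pointwise dissipation inequality.**  For `u ∈ V`, `g ∈ [Gm,GM]` and the velocity `w = g•Bu − Du`, the derivative of `Φ` along `w`,
`2⟪u,w⟫ + 2α⟪Ku,Kw⟫ − 2β(⟪Ku,Cw⟫ + ⟪Kw,Cu⟫)`, is `≤ −λ·Φ(u)` under (P1)–(P8).  Proof: the commutator identities turn it into
`−2⟪Du,u⟫ + 2αg⟪Ku,Cu⟫ − 2α⟪DKu,Ku⟫ − 2βg‖Cu‖² − 2βg⟪Ku,[C,B]u⟫ + 2β⟪Du,CKu⟫ + 2β⟪DKu,Cu⟫` and `scalar_core'` bounds it (here `B` stands for `B t`, with `[K,B t] = g•C`).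
[cite: BedrossianCotiZelati2017, §2 (proof of the hypocoercivity estimate)] [cite: Villani2009, Part I §2] -/
theorem dissipation_pointwise'' (V : Submodule ℝ F) (K B C D : F →L[ℝ] F) (g : ℝ)
    (hB : ∀ u v, ⟪B u, v⟫_ℝ = -⟪u, B v⟫_ℝ) (hCs : ∀ u v, ⟪C u, v⟫_ℝ = ⟪u, C v⟫_ℝ)
    (hKB : ∀ u, K (B u) - B (K u) = g • C u)
    (hDp : ∀ u, 0 ≤ ⟪D u, u⟫_ℝ) (hKD : ∀ u, K (D u) = D (K u)) (hVK : ∀ u ∈ V, K u ∈ V)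
    {Gm GM lo₁ CJ A η₀ η₁ η₂ η₃ U₁ U₂ U₃ α β lam : ℝ} (hGm : 0 ≤ Gm) (hlo₁ : 0 < lo₁) (hCJ : 0 < CJ)
    (hα : 0 < α) (hβ : 0 < β) (hlam : 0 ≤ lam)
    (h1 : ∀ u ∈ V, lo₁ * ‖K u‖ ^ 2 ≤ ⟪D u, u⟫_ℝ) (h2 : ∀ u ∈ V, ⟪D (C u), C u⟫_ℝ ≤ CJ * ⟪D u, u⟫_ℝ)
    (h3 : ∀ u ∈ V, ‖C u‖ ^ 2 ≤ A * ‖u‖ ^ 2)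
    (h4 : ∀ u ∈ V, -(η₀ * ⟪D u, u⟫_ℝ + η₁ * ⟪D (K u), K u⟫_ℝ) ≤ ⟪K u, C (B u) - B (C u)⟫_ℝ)
    (h5 : ∀ u ∈ V, ‖u‖ ^ 2 ≤ U₁ * ‖C u‖ ^ 2 + U₂ * ‖K u‖ ^ 2 + U₃ * ⟪D u, u⟫_ℝ)
    (h6 : ∀ u ∈ V, (⟪D u, C (K u)⟫_ℝ - ⟪D (C (K u)), u⟫_ℝ) + (⟪D (K u), C u⟫_ℝ - ⟪D (C u), K u⟫_ℝ) ≤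
      η₂ * ⟪D u, u⟫_ℝ + η₃ * ⟪D (K u), K u⟫_ℝ)
    (P1 : 4 * A * β ^ 2 ≤ α) (P2 : 16 * CJ * β ^ 2 ≤ α) (P3 : 2 * α ^ 2 * GM ^ 2 ≤ β * Gm * lo₁) (P4 : 16 * β * η₀ ≤ 1)
    (P4b : 8 * β * η₁ ≤ α) (P4c : 16 * β * η₂ ≤ 1) (P4d : 8 * β * η₃ ≤ α)
    (P5 : 6 * lam * α ≤ lo₁) (P6 : 6 * lam * U₂ ≤ lo₁) (P7 : 6 * lam * U₃ ≤ 1) (P8 : 3 * lam * U₁ ≤ 2 * β * Gm)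
    {u : F} (hu : u ∈ V) (hg : Gm ≤ g ∧ g ≤ GM) :
    2 * ⟪u, B u - D u⟫_ℝ + α * (2 * ⟪K u, K (B u - D u)⟫_ℝ)
        - 2 * β * (⟪K u, C (B u - D u)⟫_ℝ + ⟪K (B u - D u), C u⟫_ℝ)
      ≤ -(lam * (‖u‖ ^ 2 + α * ‖K u‖ ^ 2 - 2 * β * ⟪K u, C u⟫_ℝ)) := by
  have hKB' : K (B u) = g • C u + B (K u) := by rw [← hKB u]; abel
  -- the four inner products of the velocity
  have e0 : ⟪u, B u - D u⟫_ℝ = -⟪D u, u⟫_ℝ := by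
    rw [inner_sub_right, ← real_inner_comm u (B u), skew_inner_self B hB u, zero_sub, real_inner_comm (D u) u]
  have e1 : ⟪K u, K (B u - D u)⟫_ℝ = g * ⟪K u, C u⟫_ℝ - ⟪D (K u), K u⟫_ℝ := by
    rw [map_sub, hKB', hKD, inner_sub_right, inner_add_right, real_inner_smul_right,
      ← real_inner_comm (K u) (B (K u)), skew_inner_self B hB (K u), add_zero, real_inner_comm (D (K u)) (K u)]
  have e2 : ⟪K u, C (B u - D u)⟫_ℝ = ⟪K u, C (B u)⟫_ℝ - ⟪D u, C (K u)⟫_ℝ := by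
    rw [map_sub, inner_sub_right, ← hCs (K u) (D u), real_inner_comm (D u) (C (K u))]
  have e3 : ⟪K (B u - D u), C u⟫_ℝ = g * ‖C u‖ ^ 2 - ⟪K u, B (C u)⟫_ℝ - ⟪D (K u), C u⟫_ℝ := by
    rw [map_sub, hKB', hKD, inner_sub_left, inner_add_left, real_inner_smul_left, real_inner_self_eq_norm_sq,
      hB (K u) (C u)]
    ring
  have em : ⟪K u, C (B u)⟫_ℝ - ⟪K u, B (C u)⟫_ℝ = ⟪K u, C (B u) - B (C u)⟫_ℝ := by rw [inner_sub_right]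
  have lhs : 2 * ⟪u, B u - D u⟫_ℝ + α * (2 * ⟪K u, K (B u - D u)⟫_ℝ)
        - 2 * β * (⟪K u, C (B u - D u)⟫_ℝ + ⟪K (B u - D u), C u⟫_ℝ)
      = -2 * ⟪D u, u⟫_ℝ + 2 * α * g * ⟪K u, C u⟫_ℝ - 2 * α * ⟪D (K u), K u⟫_ℝ - 2 * β * g * ‖C u‖ ^ 2
        - 2 * β * ⟪K u, C (B u) - B (C u)⟫_ℝ + 2 * β * ⟪D u, C (K u)⟫_ℝ + 2 * β * ⟪D (K u), C u⟫_ℝ := by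
    rw [e0, e1, e2, e3, ← em]; ring
  rw [lhs]
  have hKu : K u ∈ V := hVK u hu
  -- Young for the symmetrised pairings; the antisymmetric remainders are h6's `od`
  have yq0 := young_form_add D hDp (by positivity : (0:ℝ) < 4 * β * CJ / α) u (C (K u))
  have yp0 := young_form_add D hDp (by positivity : (0:ℝ) < α / (4 * β)) (K u) (C u)
  have yqp : 2 * ⟪D u, C (K u)⟫_ℝ + 2 * ⟪D (K u), C u⟫_ℝ ≤ (4 * β * CJ / α) * ⟪D u, u⟫_ℝ + (4 * β * CJ / α)⁻¹ * ⟪D (C (K u)), C (K u)⟫_ℝ +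
      (α / (4 * β)) * ⟪D (K u), K u⟫_ℝ + (α / (4 * β))⁻¹ * ⟪D (C u), C u⟫_ℝ +
      ((⟪D u, C (K u)⟫_ℝ - ⟪D (C (K u)), u⟫_ℝ) + (⟪D (K u), C u⟫_ℝ - ⟪D (C u), K u⟫_ℝ)) := by linarith
  exact scalar_core'' (norm_nonneg (K u)) (norm_nonneg (C u)) (hDp u) (hDp (K u)) hGm hg hlo₁ hCJ hα hβ hlam
    (h1 u hu) (h2 u hu) (h2 (K u) hKu) (h3 u hu) (h4 u hu) (h5 u hu) (abs_real_inner_le_norm _ _) (h6 u hu) yqp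
    P1 P2 P3 P4 P4b P4c P4d P5 P6 P7 P8

/-! ## §3 The decay theorem -/

/-- **THE THREE-TERM HYPOCOERCIVE DECAY LEMMA, non-symmetric damping.**  Under the hypotheses of the module docstring and the constraints
(P1)–(P8), (P4b)–(P4d): `‖y t₁‖² ≤ 3·exp(−lam(t₁−t₀))·(‖y t₀‖² + α‖K(y t₀)‖²)`.
[cite: BedrossianCotiZelati2017, §2 (hypocoercivity functional, enhanced dissipation)] [cite: Villani2009, Part I §2 (A*A + B)] -/
theorem hypocoercive_decay'' (V : Submodule ℝ F) (K C : F →L[ℝ] F) (B D : ℝ → (F →L[ℝ] F)) (G : ℝ → ℝ) (y : ℝ → F)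
    {t₀ t₁ : ℝ} (ht : t₀ ≤ t₁)
    (hB : ∀ t u v, ⟪B t u, v⟫_ℝ = -⟪u, B t v⟫_ℝ) (hCs : ∀ u v, ⟪C u, v⟫_ℝ = ⟪u, C v⟫_ℝ)
    (hKB : ∀ t ∈ Icc t₀ t₁, ∀ u, K (B t u) - B t (K u) = G t • C u)
    (hDp : ∀ t u, 0 ≤ ⟪D t u, u⟫_ℝ) (hKD : ∀ t u, K (D t u) = D t (K u))
    (hVK : ∀ u ∈ V, K u ∈ V)
    (hyV : ∀ t ∈ Icc t₀ t₁, y t ∈ V) (hy : ∀ t ∈ Icc t₀ t₁, HasDerivAt y (B t (y t) - D t (y t)) t)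
    {Gm GM lo₁ CJ A η₀ η₁ η₂ η₃ U₁ U₂ U₃ α β lam : ℝ} (hG : ∀ t ∈ Icc t₀ t₁, Gm ≤ G t ∧ G t ≤ GM)
    (hGm : 0 ≤ Gm) (hlo₁ : 0 < lo₁) (hCJ : 0 < CJ) (hα : 0 < α) (hβ : 0 < β) (hlam : 0 ≤ lam)
    (h1 : ∀ t ∈ Icc t₀ t₁, ∀ u ∈ V, lo₁ * ‖K u‖ ^ 2 ≤ ⟪D t u, u⟫_ℝ)
    (h2 : ∀ t ∈ Icc t₀ t₁, ∀ u ∈ V, ⟪D t (C u), C u⟫_ℝ ≤ CJ * ⟪D t u, u⟫_ℝ)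
    (h3 : ∀ u ∈ V, ‖C u‖ ^ 2 ≤ A * ‖u‖ ^ 2)
    (h4 : ∀ t ∈ Icc t₀ t₁, ∀ u ∈ V, -(η₀ * ⟪D t u, u⟫_ℝ + η₁ * ⟪D t (K u), K u⟫_ℝ) ≤ ⟪K u, C (B t u) - B t (C u)⟫_ℝ)
    (h5 : ∀ t ∈ Icc t₀ t₁, ∀ u ∈ V, ‖u‖ ^ 2 ≤ U₁ * ‖C u‖ ^ 2 + U₂ * ‖K u‖ ^ 2 + U₃ * ⟪D t u, u⟫_ℝ)
    (h6 : ∀ t ∈ Icc t₀ t₁, ∀ u ∈ V, (⟪D t u, C (K u)⟫_ℝ - ⟪D t (C (K u)), u⟫_ℝ) + (⟪D t (K u), C u⟫_ℝ - ⟪D t (C u), K u⟫_ℝ) ≤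
      η₂ * ⟪D t u, u⟫_ℝ + η₃ * ⟪D t (K u), K u⟫_ℝ)
    (P1 : 4 * A * β ^ 2 ≤ α) (P2 : 16 * CJ * β ^ 2 ≤ α) (P3 : 2 * α ^ 2 * GM ^ 2 ≤ β * Gm * lo₁) (P4 : 16 * β * η₀ ≤ 1)
    (P4b : 8 * β * η₁ ≤ α) (P4c : 16 * β * η₂ ≤ 1) (P4d : 8 * β * η₃ ≤ α)
    (P5 : 6 * lam * α ≤ lo₁) (P6 : 6 * lam * U₂ ≤ lo₁) (P7 : 6 * lam * U₃ ≤ 1) (P8 : 3 * lam * U₁ ≤ 2 * β * Gm) :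
    ‖y t₁‖ ^ 2 ≤ 3 * Real.exp (-(lam * (t₁ - t₀))) * (‖y t₀‖ ^ 2 + α * ‖K (y t₀)‖ ^ 2) := by
  set Φ : ℝ → ℝ := fun s => ‖y s‖ ^ 2 + α * ‖K (y s)‖ ^ 2 - 2 * β * ⟪K (y s), C (y s)⟫_ℝ with hΦ
  -- derivative of Φ and the differential inequality
  have hΦd : ∀ t ∈ Icc t₀ t₁, HasDerivAt Φ
      (2 * ⟪y t, B t (y t) - D t (y t)⟫_ℝ + α * (2 * ⟪K (y t), K (B t (y t) - D t (y t))⟫_ℝ)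
        - 2 * β * (⟪K (y t), C (B t (y t) - D t (y t))⟫_ℝ + ⟪K (B t (y t) - D t (y t)), C (y t)⟫_ℝ)) t :=
    fun t ht => hasDerivAt_functional K C α β (hy t ht)
  have hΦle : ∀ t ∈ Icc t₀ t₁,
      2 * ⟪y t, B t (y t) - D t (y t)⟫_ℝ + α * (2 * ⟪K (y t), K (B t (y t) - D t (y t))⟫_ℝ)
        - 2 * β * (⟪K (y t), C (B t (y t) - D t (y t))⟫_ℝ + ⟪K (B t (y t) - D t (y t)), C (y t)⟫_ℝ)
      ≤ -(lam * Φ t) := fun t ht =>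
    dissipation_pointwise'' V K (B t) C (D t) (G t) (hB t) hCs (hKB t ht) (hDp t) (hKD t) hVK hGm hlo₁ hCJ hα
      hβ hlam (h1 t ht) (h2 t ht) h3 (h4 t ht) (h5 t ht) (h6 t ht) P1 P2 P3 P4 P4b P4c P4d P5 P6 P7 P8 (hyV t ht) (hG t ht)
  -- ψ = e^{λ t} Φ is antitone
  set ψ : ℝ → ℝ := fun s => Real.exp (lam * s) * Φ s with hψ
  have hψd : ∀ t ∈ Icc t₀ t₁, HasDerivAt ψ (Real.exp (lam * t) * lam * Φ t + Real.exp (lam * t) *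
      (2 * ⟪y t, B t (y t) - D t (y t)⟫_ℝ + α * (2 * ⟪K (y t), K (B t (y t) - D t (y t))⟫_ℝ)
        - 2 * β * (⟪K (y t), C (B t (y t) - D t (y t))⟫_ℝ + ⟪K (B t (y t) - D t (y t)), C (y t)⟫_ℝ))) t := by
    intro t ht
    have h1' : HasDerivAt (fun s => Real.exp (lam * s)) (Real.exp (lam * t) * lam) t := by
      simpa using ((hasDerivAt_id t).const_mul lam).exp
    exact h1'.mul (hΦd t ht)
  have hanti : AntitoneOn ψ (Icc t₀ t₁) := by
    refine antitoneOn_of_deriv_nonpos (convex_Icc t₀ t₁) ?_ ?_ ?_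
    · exact fun t ht => (hψd t ht).continuousAt.continuousWithinAt
    · intro t ht
      rw [interior_Icc] at ht
      exact (hψd t ⟨ht.1.le, ht.2.le⟩).differentiableAt.differentiableWithinAt
    · intro t ht
      rw [interior_Icc] at ht
      rw [(hψd t ⟨ht.1.le, ht.2.le⟩).deriv]
      have hle := hΦle t ⟨ht.1.le, ht.2.le⟩
      have he : 0 < Real.exp (lam * t) := Real.exp_pos _
      nlinarith
  have hmono := hanti (left_mem_Icc.2 ht) (right_mem_Icc.2 ht) ht
  -- unwind: Φ t₁ ≤ e^{-λ(t₁-t₀)} Φ t₀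
  have h3' : ∀ t ∈ Icc t₀ t₁, ‖C (y t)‖ ^ 2 ≤ A * ‖y t‖ ^ 2 := fun t ht => h3 (y t) (hyV t ht)
  have hlow : 1 / 2 * (‖y t₁‖ ^ 2 + α * ‖K (y t₁)‖ ^ 2) ≤ Φ t₁ :=
    functional_ge K C hα hβ.le P1 (y t₁) (h3' t₁ (right_mem_Icc.2 ht))
  have hup : Φ t₀ ≤ 3 / 2 * (‖y t₀‖ ^ 2 + α * ‖K (y t₀)‖ ^ 2) :=
    functional_le K C hα hβ.le P1 (y t₀) (h3' t₀ (left_mem_Icc.2 ht))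
  have hexp : Real.exp (lam * t₁) * Φ t₁ ≤ Real.exp (lam * t₀) * Φ t₀ := by simpa [hψ] using hmono
  have he1 : 0 < Real.exp (lam * t₁) := Real.exp_pos _
  have hΦ1 : Φ t₁ ≤ Real.exp (-(lam * (t₁ - t₀))) * Φ t₀ := by
    have hmul := mul_le_mul_of_nonneg_left hexp (Real.exp_pos (-(lam * t₁))).le
    have e1 : Real.exp (-(lam * t₁)) * (Real.exp (lam * t₁) * Φ t₁) = Φ t₁ := by
      rw [← mul_assoc, ← Real.exp_add]; simp
    have e2 : Real.exp (-(lam * t₁)) * (Real.exp (lam * t₀) * Φ t₀) = Real.exp (-(lam * (t₁ - t₀))) * Φ t₀ := by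
      rw [← mul_assoc, ← Real.exp_add]; congr 1; ring_nf
    rw [e1, e2] at hmul
    exact hmul
  have hK0 : 0 ≤ α * ‖K (y t₁)‖ ^ 2 := by positivity
  have hE : 0 ≤ Real.exp (-(lam * (t₁ - t₀))) := (Real.exp_pos _).le
  have : Real.exp (-(lam * (t₁ - t₀))) * Φ t₀ ≤ Real.exp (-(lam * (t₁ - t₀))) * (3 / 2 * (‖y t₀‖ ^ 2 + α * ‖K (y t₀)‖ ^ 2)) :=
    mul_le_mul_of_nonneg_left hup hE
  nlinarith


/-- **Non-symmetric damping, MEAN-VALUE START**: under the hypotheses of `hypocoercive_decay''` and `0 < δ₁`, `t₀ + δ₁ ≤ t₁`: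
`‖y t₁‖² ≤ 3(1 + α/(2δ₁lo₁))·exp(−lam(t₁−t₀−δ₁))·‖y t₀‖²`. [cite: BedrossianCotiZelati2017, §2] [cite: Villani2009, Part I §2] -/
theorem hypocoercive_decay_started'' (V : Submodule ℝ F) (K C : F →L[ℝ] F) (B D : ℝ → (F →L[ℝ] F)) (G : ℝ → ℝ) (y : ℝ → F)
    {t₀ t₁ δ₁ : ℝ} (hδ : 0 < δ₁) (hδt : t₀ + δ₁ ≤ t₁)
    (hB : ∀ t u v, ⟪B t u, v⟫_ℝ = -⟪u, B t v⟫_ℝ) (hCs : ∀ u v, ⟪C u, v⟫_ℝ = ⟪u, C v⟫_ℝ)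
    (hKB : ∀ t ∈ Icc t₀ t₁, ∀ u, K (B t u) - B t (K u) = G t • C u)
    (hDp : ∀ t u, 0 ≤ ⟪D t u, u⟫_ℝ) (hKD : ∀ t u, K (D t u) = D t (K u))
    (hVK : ∀ u ∈ V, K u ∈ V)
    (hyV : ∀ t ∈ Icc t₀ t₁, y t ∈ V) (hy : ∀ t ∈ Icc t₀ t₁, HasDerivAt y (B t (y t) - D t (y t)) t)
    {Gm GM lo₁ CJ A η₀ η₁ η₂ η₃ U₁ U₂ U₃ α β lam : ℝ} (hG : ∀ t ∈ Icc t₀ t₁, Gm ≤ G t ∧ G t ≤ GM)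
    (hGm : 0 ≤ Gm) (hlo₁ : 0 < lo₁) (hCJ : 0 < CJ) (hα : 0 < α) (hβ : 0 < β) (hlam : 0 ≤ lam)
    (h1 : ∀ t ∈ Icc t₀ t₁, ∀ u ∈ V, lo₁ * ‖K u‖ ^ 2 ≤ ⟪D t u, u⟫_ℝ)
    (h2 : ∀ t ∈ Icc t₀ t₁, ∀ u ∈ V, ⟪D t (C u), C u⟫_ℝ ≤ CJ * ⟪D t u, u⟫_ℝ)
    (h3 : ∀ u ∈ V, ‖C u‖ ^ 2 ≤ A * ‖u‖ ^ 2)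
    (h4 : ∀ t ∈ Icc t₀ t₁, ∀ u ∈ V, -(η₀ * ⟪D t u, u⟫_ℝ + η₁ * ⟪D t (K u), K u⟫_ℝ) ≤ ⟪K u, C (B t u) - B t (C u)⟫_ℝ)
    (h5 : ∀ t ∈ Icc t₀ t₁, ∀ u ∈ V, ‖u‖ ^ 2 ≤ U₁ * ‖C u‖ ^ 2 + U₂ * ‖K u‖ ^ 2 + U₃ * ⟪D t u, u⟫_ℝ)
    (h6 : ∀ t ∈ Icc t₀ t₁, ∀ u ∈ V, (⟪D t u, C (K u)⟫_ℝ - ⟪D t (C (K u)), u⟫_ℝ) + (⟪D t (K u), C u⟫_ℝ - ⟪D t (C u), K u⟫_ℝ) ≤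
      η₂ * ⟪D t u, u⟫_ℝ + η₃ * ⟪D t (K u), K u⟫_ℝ)
    (P1 : 4 * A * β ^ 2 ≤ α) (P2 : 16 * CJ * β ^ 2 ≤ α) (P3 : 2 * α ^ 2 * GM ^ 2 ≤ β * Gm * lo₁) (P4 : 16 * β * η₀ ≤ 1)
    (P4b : 8 * β * η₁ ≤ α) (P4c : 16 * β * η₂ ≤ 1) (P4d : 8 * β * η₃ ≤ α)
    (P5 : 6 * lam * α ≤ lo₁) (P6 : 6 * lam * U₂ ≤ lo₁) (P7 : 6 * lam * U₃ ≤ 1) (P8 : 3 * lam * U₁ ≤ 2 * β * Gm) :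
    ‖y t₁‖ ^ 2 ≤ 3 * (1 + α / (2 * δ₁ * lo₁)) * Real.exp (-(lam * (t₁ - t₀ - δ₁))) * ‖y t₀‖ ^ 2 := by
  obtain ⟨c, hc, hform⟩ := exists_form_le B D y hδ hδt hB hy
  have hc0 : t₀ ≤ c := hc.1.le
  have hc1 : c ≤ t₁ := hc.2.le.trans hδt
  have hsub : Icc c t₁ ⊆ Icc t₀ t₁ := Icc_subset_Icc hc0 le_rfl
  have hmain := hypocoercive_decay'' V K C B D G y hc1 hB hCs (fun t ht => hKB t (hsub ht)) hDp hKD hVK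
    (fun t ht => hyV t (hsub ht))
    (fun t ht => hy t (hsub ht)) (fun t ht => hG t (hsub ht)) hGm hlo₁ hCJ hα hβ hlam (fun t ht => h1 t (hsub ht))
    (fun t ht => h2 t (hsub ht)) h3 (fun t ht => h4 t (hsub ht)) (fun t ht => h5 t (hsub ht)) (fun t ht => h6 t (hsub ht))
    P1 P2 P3 P4 P4b P4c P4d P5 P6 P7 P8
  have hcI : c ∈ Icc t₀ t₁ := ⟨hc0, hc1⟩
  have hKc : α * ‖K (y c)‖ ^ 2 ≤ α / (2 * δ₁ * lo₁) * ‖y t₀‖ ^ 2 := by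
    have h := (h1 c hcI (y c) (hyV c hcI)).trans hform
    have h' : ‖K (y c)‖ ^ 2 ≤ ‖y t₀‖ ^ 2 / (2 * δ₁ * lo₁) := by
      rw [le_div_iff₀ (by positivity)]
      have := mul_le_mul_of_nonneg_right h (by positivity : (0:ℝ) ≤ 2 * δ₁)
      have e : ‖y t₀‖ ^ 2 / (2 * δ₁) * (2 * δ₁) = ‖y t₀‖ ^ 2 := by field_simp
      rw [e] at this
      nlinarith
    have h'' := mul_le_mul_of_nonneg_left h' hα.le
    have e : α * (‖y t₀‖ ^ 2 / (2 * δ₁ * lo₁)) = α / (2 * δ₁ * lo₁) * ‖y t₀‖ ^ 2 := by ring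
    rw [e] at h''
    exact h''
  have hyc : ‖y c‖ ^ 2 ≤ ‖y t₀‖ ^ 2 :=
    norm_sq_antitoneOn B D y hB hDp hy (left_mem_Icc.2 (hc0.trans hc1)) hcI hc0
  have hexp : Real.exp (-(lam * (t₁ - c))) ≤ Real.exp (-(lam * (t₁ - t₀ - δ₁))) := by
    apply Real.exp_le_exp.2
    have : t₁ - t₀ - δ₁ ≤ t₁ - c := by linarith [hc.2]
    nlinarith
  have hsum : ‖y c‖ ^ 2 + α * ‖K (y c)‖ ^ 2 ≤ (1 + α / (2 * δ₁ * lo₁)) * ‖y t₀‖ ^ 2 := by nlinarith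
  have hpos : 0 ≤ (1 + α / (2 * δ₁ * lo₁)) * ‖y t₀‖ ^ 2 := by positivity
  calc ‖y t₁‖ ^ 2 ≤ 3 * Real.exp (-(lam * (t₁ - c))) * (‖y c‖ ^ 2 + α * ‖K (y c)‖ ^ 2) := hmain
    _ ≤ 3 * Real.exp (-(lam * (t₁ - c))) * ((1 + α / (2 * δ₁ * lo₁)) * ‖y t₀‖ ^ 2) :=
        mul_le_mul_of_nonneg_left hsum (by positivity)
    _ ≤ 3 * Real.exp (-(lam * (t₁ - t₀ - δ₁))) * ((1 + α / (2 * δ₁ * lo₁)) * ‖y t₀‖ ^ 2) :=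
        mul_le_mul_of_nonneg_right (mul_le_mul_of_nonneg_left hexp (by norm_num)) hpos
    _ = 3 * (1 + α / (2 * δ₁ * lo₁)) * Real.exp (-(lam * (t₁ - t₀ - δ₁))) * ‖y t₀‖ ^ 2 := by ring

end

end Summit.AnomalousDissipation.AnomalousDissipation.Theorems.SolenoidalFractalHomogenisation.LagrangianStep.LadderCrush
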